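import Summits.AtomisticToContinuum.HydrodynamicLimit.Theorems.InformationPercolationEngineChaosClosesEulerStressIsotropyE
import Summits.AtomisticToContinuum.HydrodynamicLimit.Theorems.InformationPercolationEngineKineticClosureBridge
import HarnessLib

/-!
# Weak stress isotropy in band (crux `ChaosClosesEuler`, stmt-AtomisticToContinuum-15141, line `Sketch`,
# stub `stub_stressIsotropyOfLocalEquilibrium`) — helper F: the estimate in probability

WHAT. `weakStressIsotropy_inProbability`: at fixed `σ ≤ 1/2`, profiles, flow family, `t ≥ 0`, traceless continuous
`a`, continuous `g` vanishing on `[η₀, ∞)`, given POINTWISE LOCAL EQUILIBRIUM at `(σ, t)` (hypothesis, the format of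
`PointwiseLocalEquilibrium` specialised) and the CUBIC VELOCITY TAILS at `t` (hypothesis, the format of
`TwoClocks.EnergyCurrentTails` specialised): for `η, δ > 0` there are `r₀` and `N₀(r)` with
`P_N(η < |∫₀ᵗ∫ₓ g(σ³ρ_r) Σ a_{jk} P_{jk}|) ≤ δ`.

PROOF. All tolerances are chosen before `r` (`stub_stressIsotropyBudget`): `δ' = δ/12`; the energy level `K`
(`KineticClosureBridge.exists_energy_tail_le`); `θ₁, κ, η'`; the tail level `M ≥ 1` from the cubic tails at
tolerance `δ'κ/(t+1)`; `Θ, U` (hot / fast); `ρ₁`; the bulk weight `h = χ · g(σ³·)` and the ten bounded continuous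
tests `ψ_{jk} = vⱼvₖφ_M`, `ψ_E = ‖v‖²φ_M` fed to pointwise local equilibrium at `(η', δ')`; `r₀ = min r₀'s ∧ 1/2`,
`N₀ = max N₀'s`.  Off the null bad set and twelve bad events of probability `≤ δ'` each (energy, windowed cubic tail by
Tonelli + Markov `measure_lt_intervalIntegral_flow_le`, ten PLE events) the pathwise estimate of helper E gives
`|…| ≤ 5η/6`.

No named fact is invoked.
-/

noncomputable section

namespace Summit.AtomisticToContinuum.HydrodynamicLimit.Theorems.ChaosClosesEulerStressIsotropy

open scoped BigOperators Topology Classical MeasureTheory ENNReal InnerProductSpace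
open Filter Set MeasureTheory Function
open Literature.MathematicalPhysics.KineticTheory
open Literature.Analysis.FluidPDE
open Literature.Analysis.FunctionSpaces
open Summit.AtomisticToContinuum.HydrodynamicLimit.Theorems.LocalSecondLawNegative
open Summit.AtomisticToContinuum.HydrodynamicLimit.Theorems.LocalSecondLawLedger
open Summit.AtomisticToContinuum.HydrodynamicLimit.Theorems.LocalSecondLawLedger.L
  (Mmom rhoC_eq_sum momC_apply_eq_sum momC_eq_sum uC_apply norm_sq_eq_sum)
open Summit.AtomisticToContinuum.HydrodynamicLimit.Theorems.ChaosClosesEulerReduction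

variable {N : ℕ}

/-! ## §1 The budget -/

/-- `x · (c/(x+1)) ≤ c` for `x, c ≥ 0`. [folklore] -/
theorem mul_div_add_one_le {x c : ℝ} (hx : 0 ≤ x) (hc : 0 ≤ c) : x * (c / (x + 1)) ≤ c := by
  rw [mul_div_assoc', div_le_iff₀ (by positivity)]
  nlinarith

/-- `X / (12X/η + 1) ≤ η/12` for `X ≥ 0`, `η > 0`. [folklore] -/
theorem div_level_le {X η : ℝ} (hX : 0 ≤ X) (hη : 0 < η) : X / (12 * X / η + 1) ≤ η / 12 := by
  rw [div_le_iff₀ (by positivity)]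
  have : η / 12 * (12 * X / η + 1) = X + η / 12 := by field_simp
  rw [this]
  linarith

/-- **Registered sub-goal `stub_stressIsotropyBudget` (helper F of `stub_stressIsotropyOfLocalEquilibrium`): the
tolerance budget of the stress-isotropy estimate** — with the cut-off levels chosen as below, the pathwise bound of
helper E is at most `η`. [folklore] -/
theorem stub_stressIsotropyBudget : ∀ {η t Gb A K M θ₁ ρ₁ Θ U κ η' : ℝ}, 0 < η → 0 ≤ t → 0 ≤ Gb → 0 ≤ A → 0 ≤ K → θ₁ = η / (6 * (90 * Gb * A * t + 1)) → Θ = 12 * (45 * Gb * A * t * (4 * M ^ 2 / 9) * K) / η + 1 → U = 12 * (45 * Gb * A * t * (8 * M ^ 2 / 3) * K) / η + 1 → ρ₁ = η / (6 * (45 * Gb * A * t * Θ + 1)) → κ = η / (6 * (48 * Gb * A + 1)) → η' = η / (6 * (18 * A + 1)) → 45 * Gb * A * t * (2 * θ₁ + ρ₁ * Θ + (4 * M ^ 2 / (9 * Θ) + 8 * M ^ 2 / (3 * U ^ 2)) * K) + 48 * Gb * A * κ + 18 * A * η' ≤ η := by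
  intro η t Gb A K M θ₁ ρ₁ Θ U κ η' hη ht hGb hA hK hθ₁ hΘ hU hρ₁ hκ hη'
  have hX : 0 ≤ 45 * Gb * A * t * (4 * M ^ 2 / 9) * K := by positivity
  have hY : 0 ≤ 45 * Gb * A * t * (8 * M ^ 2 / 3) * K := by positivity
  have hΘ0 : 0 < Θ := by rw [hΘ]; positivity
  have hU1 : 1 ≤ U := by rw [hU]; linarith [show 0 ≤ 12 * (45 * Gb * A * t * (8 * M ^ 2 / 3) * K) / η by positivity]
  have hU0 : 0 < U := by linarith
  -- the six pieces
  have h1 : 45 * Gb * A * t * (2 * θ₁) ≤ η / 6 := by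
    rw [hθ₁]
    have := mul_div_add_one_le (x := 90 * Gb * A * t) (c := η / 6) (by positivity) (by positivity)
    calc 45 * Gb * A * t * (2 * (η / (6 * (90 * Gb * A * t + 1)))) = 90 * Gb * A * t * (η / 6 / (90 * Gb * A * t + 1)) := by
          rw [div_div]; ring
      _ ≤ η / 6 := this
  have h2 : 45 * Gb * A * t * (ρ₁ * Θ) ≤ η / 6 := by
    rw [hρ₁]
    have := mul_div_add_one_le (x := 45 * Gb * A * t * Θ) (c := η / 6) (by positivity) (by positivity)
    calc 45 * Gb * A * t * (η / (6 * (45 * Gb * A * t * Θ + 1)) * Θ) =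
        45 * Gb * A * t * Θ * (η / 6 / (45 * Gb * A * t * Θ + 1)) := by rw [div_div]; ring
      _ ≤ η / 6 := this
  have h3 : 45 * Gb * A * t * (4 * M ^ 2 / (9 * Θ) * K) ≤ η / 12 := by
    have := div_level_le hX hη
    rw [← hΘ] at this
    calc 45 * Gb * A * t * (4 * M ^ 2 / (9 * Θ) * K) = 45 * Gb * A * t * (4 * M ^ 2 / 9) * K / Θ := by
          ring
      _ ≤ η / 12 := this
  have h4 : 45 * Gb * A * t * (8 * M ^ 2 / (3 * U ^ 2) * K) ≤ η / 12 := by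
    have := div_level_le hY hη
    rw [← hU] at this
    have hUU : U ≤ U ^ 2 := by nlinarith
    calc 45 * Gb * A * t * (8 * M ^ 2 / (3 * U ^ 2) * K) = 45 * Gb * A * t * (8 * M ^ 2 / 3) * K / U ^ 2 := by
          ring
      _ ≤ 45 * Gb * A * t * (8 * M ^ 2 / 3) * K / U := div_le_div_of_nonneg_left hY hU0 hUU
      _ ≤ η / 12 := this
  have h5 : 48 * Gb * A * κ ≤ η / 6 := by
    rw [hκ]
    have := mul_div_add_one_le (x := 48 * Gb * A) (c := η / 6) (by positivity) (by positivity)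
    calc 48 * Gb * A * (η / (6 * (48 * Gb * A + 1))) = 48 * Gb * A * (η / 6 / (48 * Gb * A + 1)) := by
          rw [div_div]
      _ ≤ η / 6 := this
  have h6 : 18 * A * η' ≤ η / 6 := by
    rw [hη']
    have := mul_div_add_one_le (x := 18 * A) (c := η / 6) (by positivity) (by positivity)
    calc 18 * A * (η / (6 * (18 * A + 1))) = 18 * A * (η / 6 / (18 * A + 1)) := by rw [div_div]
      _ ≤ η / 6 := this
  have hsplit : 45 * Gb * A * t * (2 * θ₁ + ρ₁ * Θ + (4 * M ^ 2 / (9 * Θ) + 8 * M ^ 2 / (3 * U ^ 2)) * K) =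
      45 * Gb * A * t * (2 * θ₁) + 45 * Gb * A * t * (ρ₁ * Θ) + 45 * Gb * A * t * (4 * M ^ 2 / (9 * Θ) * K) +
        45 * Gb * A * t * (8 * M ^ 2 / (3 * U ^ 2) * K) := by ring
  rw [hsplit]
  linarith

/-! ## §2 The union bound -/

/-- **Union bound**: a null set, three bad events and a finite family of bad events, each of probability `≤ δ'`,
cover the target event. [folklore] -/
theorem measure_le_of_cover {Ω : Type*} [MeasurableSpace Ω] (P : Measure Ω) {ι : Type*} [Fintype ι]
    {Z S₁ S₂ S₃ D : Set Ω} {S : ι → Set Ω} (hZ : P Z = 0) {δ' : ℝ}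
    (h₁ : P S₁ ≤ ENNReal.ofReal δ') (h₂ : P S₂ ≤ ENNReal.ofReal δ') (h₃ : P S₃ ≤ ENNReal.ofReal δ')
    (hS : ∀ i, P (S i) ≤ ENNReal.ofReal δ')
    (hD : ∀ z, z ∉ Z → z ∉ S₁ → z ∉ S₂ → z ∉ S₃ → (∀ i, z ∉ S i) → z ∉ D) :
    P D ≤ ENNReal.ofReal ((3 + Fintype.card ι) * δ') := by
  have hsub : D ⊆ Z ∪ S₁ ∪ S₂ ∪ S₃ ∪ ⋃ i, S i := by
    intro z hz
    by_contra hcon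
    simp only [Set.mem_union, Set.mem_iUnion, not_or, not_exists] at hcon
    obtain ⟨⟨⟨⟨n0, n1⟩, n2⟩, n3⟩, n4⟩ := hcon
    exact hD z n0 n1 n2 n3 n4 hz
  have hU : P (⋃ i, S i) ≤ (Fintype.card ι : ℝ≥0∞) * ENNReal.ofReal δ' :=
    calc P (⋃ i, S i) ≤ ∑ i, P (S i) := measure_iUnion_fintype_le P S
      _ ≤ ∑ _i : ι, ENNReal.ofReal δ' := Finset.sum_le_sum fun i _ => hS i
      _ = (Fintype.card ι : ℝ≥0∞) * ENNReal.ofReal δ' := by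
          rw [Finset.sum_const, Finset.card_univ, nsmul_eq_mul]
  calc P D ≤ P (Z ∪ S₁ ∪ S₂ ∪ S₃ ∪ ⋃ i, S i) := measure_mono hsub
    _ ≤ P (Z ∪ S₁ ∪ S₂ ∪ S₃) + P (⋃ i, S i) := measure_union_le _ _
    _ ≤ P (Z ∪ S₁ ∪ S₂) + P S₃ + P (⋃ i, S i) := by gcongr; exact measure_union_le _ _
    _ ≤ P (Z ∪ S₁) + P S₂ + P S₃ + P (⋃ i, S i) := by gcongr; exact measure_union_le _ _
    _ ≤ P Z + P S₁ + P S₂ + P S₃ + P (⋃ i, S i) := by gcongr; exact measure_union_le _ _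
    _ ≤ 0 + ENNReal.ofReal δ' + ENNReal.ofReal δ' + ENNReal.ofReal δ' + (Fintype.card ι : ℝ≥0∞) * ENNReal.ofReal δ' := by
        gcongr
        exact hZ.le
    _ = (3 + (Fintype.card ι : ℝ≥0∞)) * ENNReal.ofReal δ' := by ring
    _ = ENNReal.ofReal ((3 + Fintype.card ι) * δ') := by
        rw [ENNReal.ofReal_mul (by positivity), ENNReal.ofReal_add (by norm_num) (by positivity),
          ENNReal.ofReal_natCast, ENNReal.ofReal_ofNat]

/-! ## §3 Bounds of the data -/

/-- A continuous `g` vanishing on `[η₀, ∞)` is bounded on `[0, ∞)`. [folklore] -/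
theorem exists_bound_of_vanishing {g : ℝ → ℝ} (hgc : Continuous g) {η₀ : ℝ} (hg0 : ∀ b, η₀ ≤ b → g b = 0) :
    ∃ Gb : ℝ, 0 ≤ Gb ∧ ∀ b, 0 ≤ b → |g b| ≤ Gb := by
  obtain ⟨C, hC⟩ := isCompact_Icc.exists_bound_of_continuousOn (hgc.continuousOn (s := Set.Icc 0 η₀))
  refine ⟨max C 0, le_max_right _ _, fun b hb => ?_⟩
  by_cases hbη : η₀ ≤ b
  · rw [hg0 b hbη, abs_zero]; exact le_max_right _ _
  · rw [not_le] at hbη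
    rw [← Real.norm_eq_abs]
    exact (hC b ⟨hb, hbη.le⟩).trans (le_max_left _ _)

/-- One bound for the nine entries of a continuous matrix field on `[0, t] × 𝕋³`. [folklore] -/
theorem exists_bound_matrix (a : Fin 3 → Fin 3 → ℝ × T3 → ℝ) (hac : ∀ j k, Continuous (a j k)) (t : ℝ) :
    ∃ A : ℝ, 0 ≤ A ∧ ∀ j k, ∀ s ∈ Set.Icc 0 t, ∀ x, |a j k (s, x)| ≤ A := by
  have hjk : ∀ j k, ∃ C : ℝ, 0 ≤ C ∧ ∀ s ∈ Set.Icc 0 t, ∀ x, |a j k (s, x)| ≤ C := by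
    intro j k
    obtain ⟨C, hC0, hC⟩ := ChaosClosesEulerReadout.exists_bound_of_continuousOn_uncurry
      (u := fun s x => a j k (s, x)) (a := 0) (b := t)
      (((hac j k).comp (continuous_fst.prodMk continuous_snd)).continuousOn)
    exact ⟨C, hC0, fun s hs x => by rw [← Real.norm_eq_abs]; exact hC s hs x⟩
  choose C hC0 hC using hjk
  refine ⟨∑ j, ∑ k, C j k, Finset.sum_nonneg fun j _ => Finset.sum_nonneg fun k _ => hC0 j k, fun j k s hs x => ?_⟩
  calc |a j k (s, x)| ≤ C j k := hC j k s hs x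
    _ ≤ ∑ k', C j k' := Finset.single_le_sum (f := fun k' => C j k') (fun k' _ => hC0 j k') (Finset.mem_univ k)
    _ ≤ ∑ j', ∑ k', C j' k' :=
        Finset.single_le_sum (f := fun j' => ∑ k', C j' k') (fun j' _ => Finset.sum_nonneg fun k' _ => hC0 j' k')
          (Finset.mem_univ j)

/-! ## §4 The estimate in probability -/

/-- **WEAK STRESS ISOTROPY IN BAND, IN PROBABILITY, AT FIXED `(σ, t)`** — from pointwise local equilibrium at
`(σ, t)`, the cubic velocity tails at `t`, the Maxwellian moments and energy tightness (see the module docstring for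
the order of the choices). [folklore] -/
theorem weakStressIsotropy_inProbability
    (hMM : ∀ (ρ θ : ℝ) (u : V3), 0 < ρ → 0 < θ →
      let m : Measure V3 := volume.withDensity (fun v => ENNReal.ofReal (localMaxwellian ρ θ u v))
      IsFiniteMeasure m ∧ Integrable (fun v : V3 => ‖v‖ ^ 2) m ∧
      (m Set.univ).toReal = ρ ∧ (∀ j : Fin 3, ∫ v, v j ∂m = ρ * u j) ∧
      (∀ j k : Fin 3, ∫ v, v j * v k ∂m = ρ * (u j * u k + if j = k then θ else 0)) ∧
      (∫ v, ‖v‖ ^ 2 ∂m = ρ * (‖u‖ ^ 2 + 3 * θ)) ∧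
      (∀ ψ : V3 → ℝ, Continuous ψ → (∃ C : ℝ, ∀ v, |ψ v| ≤ C) →
        Integrable ψ m ∧ ∫ v, ψ v ∂m = ρ * ∫ v, ψ v * localMaxwellian 1 θ u v))
    {σ : ℝ} (hσ : 0 < σ) (hσ2 : σ ≤ 1 / 2) {a₀ θ₀ : T3 → ℝ} {u₀ : T3 → V3} (ha : Continuous a₀)
    (hθc : Continuous θ₀) (hu : Continuous u₀) (ha0 : ∀ x, 0 < a₀ x) (hθ0 : ∀ x, 0 < θ₀ x)
    (Φ : (N : ℕ) → HardSphereFlow (Torus.geometry (Fin 3)) (hsDiameter σ N) (N + 1)) {t : ℝ} (ht : 0 ≤ t)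
    {η₀ : ℝ}
    (hPLE : ∀ ψ : V3 → ℝ, Continuous ψ → (∃ C : ℝ, ∀ v, |ψ v| ≤ C) →
      ∀ h : ℝ × V3 × ℝ → ℝ, Continuous h → (∃ C : ℝ, ∀ p, |h p| ≤ C) →
      (∃ ρ₁ θ₁ Θ U : ℝ, 0 < ρ₁ ∧ 0 < θ₁ ∧ ∀ p : ℝ × V3 × ℝ,
        (p.1 ≤ ρ₁ ∨ η₀ ≤ σ ^ 3 * p.1 ∨ p.2.2 ≤ θ₁ ∨ Θ ≤ p.2.2 ∨ U ≤ ‖p.2.1‖) → h p = 0) →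
      ∀ η δ : ℝ, 0 < η → 0 < δ → ∃ r₀ : ℝ, 0 < r₀ ∧ ∀ r : ℝ, 0 < r → r < r₀ → ∃ N₀ : ℕ, ∀ N : ℕ, N₀ ≤ N →
      localGibbsLaw σ a₀ u₀ θ₀ N (Φ N)
        {z | η < ∫ s in Set.Icc 0 t, ∫ x,
          |h (rhoC r ((Φ N).flow s z) x, uC r ((Φ N).flow s z) x, thetaC r ((Φ N).flow s z) x)| *
            |MpsiC r ((Φ N).flow s z) x ψ - rhoC r ((Φ N).flow s z) x *
              ∫ v, ψ v * localMaxwellian 1 (thetaC r ((Φ N).flow s z) x) (uC r ((Φ N).flow s z) x) v|} ≤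
          ENNReal.ofReal δ)
    (hECT : ∀ ε : ℝ, 0 < ε → ∃ M : ℝ, ∃ N₀ : ℕ, ∀ N : ℕ, N₀ ≤ N → ∀ s ∈ Set.Icc 0 t,
      ∫⁻ z, ENNReal.ofReal (((N : ℝ) + 1)⁻¹ * ∑ i : Fin (N + 1),
        Set.indicator {v : V3 | M < ‖v‖} (fun v => ‖v‖ ^ 3) (((Φ N).flow s z i).2))
          ∂(localGibbsLaw σ a₀ u₀ θ₀ N (Φ N)) ≤ ENNReal.ofReal ε)
    (a : Fin 3 → Fin 3 → ℝ × T3 → ℝ) (hac : ∀ j k, Continuous (a j k)) (htr : ∀ p, ∑ j, a j j p = 0)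
    (g : ℝ → ℝ) (hgc : Continuous g) (hg0 : ∀ b, η₀ ≤ b → g b = 0) {η δ : ℝ} (hη : 0 < η) (hδ : 0 < δ) :
    ∃ r₀ : ℝ, 0 < r₀ ∧ ∀ r : ℝ, 0 < r → r < r₀ → ∃ N₀ : ℕ, ∀ N : ℕ, N₀ ≤ N →
      localGibbsLaw σ a₀ u₀ θ₀ N (Φ N)
        {z | η < |∫ s in Set.Icc 0 t, ∫ x, g (σ ^ 3 * rhoC r ((Φ N).flow s z) x) *
          ∑ j, ∑ k, a j k (s, x) * (MpsiC r ((Φ N).flow s z) x (fun v => v j * v k) -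
            momC r ((Φ N).flow s z) x j * momC r ((Φ N).flow s z) x k / rhoC r ((Φ N).flow s z) x)|} ≤
        ENNReal.ofReal δ := by
  -- ### the data: bounds of `g` and `a`
  obtain ⟨Gb, hGb0, hGb⟩ := exists_bound_of_vanishing hgc hg0
  obtain ⟨A, hA0, hA⟩ := exists_bound_matrix a hac t
  -- ### the tolerances, in order
  have hδ' : 0 < δ / 12 := by positivity
  obtain ⟨K, hK0, hKev⟩ := KineticClosureBridge.exists_energy_tail_le (u₀ := u₀) ha hθc hu ha0 hθ0 hσ2 hδ'
  set θ₁ := η / (6 * (90 * Gb * A * t + 1)) with hθ₁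
  set κ := η / (6 * (48 * Gb * A + 1)) with hκ
  set η' := η / (6 * (18 * A + 1)) with hη'
  have hθ₁0 : 0 < θ₁ := by positivity
  have hκ0 : 0 < κ := by positivity
  have hη'0 : 0 < η' := by positivity
  have hεE : 0 < δ / 12 * κ / (t + 1) := by positivity
  obtain ⟨M₀, N₀E, hECT'⟩ := hECT (δ / 12 * κ / (t + 1)) hεE
  set M := max M₀ 1 with hMdef
  have hM : 1 ≤ M := le_max_right _ _
  have hM₀ : M₀ ≤ M := le_max_left _ _
  set Θ := 12 * (45 * Gb * A * t * (4 * M ^ 2 / 9) * K) / η + 1 with hΘ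
  set U := 12 * (45 * Gb * A * t * (8 * M ^ 2 / 3) * K) / η + 1 with hU
  have hΘ0 : 0 < Θ := by positivity
  have hU0 : 0 < U := by positivity
  set ρ₁ := η / (6 * (45 * Gb * A * t * Θ + 1)) with hρ₁
  have hρ₁0 : 0 < ρ₁ := by positivity
  -- ### the bulk weight and the tests
  set h : ℝ × V3 × ℝ → ℝ := fun p => bulkCut ρ₁ θ₁ Θ U p * g (σ ^ 3 * p.1) with hhdef
  have hh : ∀ p, h p = bulkCut ρ₁ θ₁ Θ U p * g (σ ^ 3 * p.1) := fun p => rfl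
  have hhc : Continuous h := continuous_bulkWeight hgc hh
  have hhb : ∀ p, |h p| ≤ Gb := abs_bulkWeight_le hρ₁0 hθ₁0 hΘ0 hU0 hσ.le hGb0 hGb hh
  have hsupp : ∀ p : ℝ × V3 × ℝ, (p.1 ≤ ρ₁ ∨ η₀ ≤ σ ^ 3 * p.1 ∨ p.2.2 ≤ θ₁ ∨ Θ ≤ p.2.2 ∨ U ≤ ‖p.2.1‖) →
      h p = 0 := by
    intro p hp
    rcases hp with hp | hp | hp
    · rw [hh, bulkCut_eq_zero (p := p) hρ₁0 hθ₁0 hΘ0 hU0 (Or.inl hp), zero_mul]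
    · rw [hh, hg0 _ hp, mul_zero]
    · rw [hh, bulkCut_eq_zero (p := p) hρ₁0 hθ₁0 hΘ0 hU0 (Or.inr hp), zero_mul]
  have hPJ : ∀ jk : Fin 3 × Fin 3, ∃ r₀ : ℝ, 0 < r₀ ∧ ∀ r : ℝ, 0 < r → r < r₀ → ∃ N₀ : ℕ, ∀ N : ℕ, N₀ ≤ N →
      localGibbsLaw σ a₀ u₀ θ₀ N (Φ N)
        {z | η' < ∫ s in Set.Icc 0 t, ∫ x,
          |h (rhoC r ((Φ N).flow s z) x, uC r ((Φ N).flow s z) x, thetaC r ((Φ N).flow s z) x)| *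
            |MpsiC r ((Φ N).flow s z) x (psiJK M jk.1 jk.2) - rhoC r ((Φ N).flow s z) x *
              ∫ v, psiJK M jk.1 jk.2 v *
                localMaxwellian 1 (thetaC r ((Φ N).flow s z) x) (uC r ((Φ N).flow s z) x) v|} ≤
          ENNReal.ofReal (δ / 12) := fun jk =>
    hPLE (psiJK M jk.1 jk.2) (continuous_psiJK M jk.1 jk.2) ⟨(M + 1) ^ 2, abs_psiJK_le M jk.1 jk.2⟩ h hhc
      ⟨Gb, hhb⟩ ⟨ρ₁, θ₁, Θ, U, hρ₁0, hθ₁0, hsupp⟩ η' (δ / 12) hη'0 hδ'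
  choose rJ hrJ HJ using hPJ
  obtain ⟨rE, hrE, HE⟩ := hPLE (psiE M) (continuous_psiE M) ⟨(M + 1) ^ 2, abs_psiE_le M⟩ h hhc ⟨Gb, hhb⟩
    ⟨ρ₁, θ₁, Θ, U, hρ₁0, hθ₁0, hsupp⟩ η' (δ / 12) hη'0 hδ'
  -- ### the mollification threshold
  refine ⟨min (Finset.univ.inf' Finset.univ_nonempty rJ) (min rE (1 / 2)),
    lt_min ((Finset.lt_inf'_iff _).2 fun jk _ => hrJ jk) (lt_min hrE (by norm_num)), fun r hr hrr₀ => ?_⟩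
  have hrJ' : ∀ jk, r < rJ jk := fun jk =>
    hrr₀.trans_le ((min_le_left _ _).trans (Finset.inf'_le _ (Finset.mem_univ jk)))
  have hrE' : r < rE := hrr₀.trans_le ((min_le_right _ _).trans (min_le_left _ _))
  have hr2 : r < 1 / 2 := hrr₀.trans_le ((min_le_right _ _).trans (min_le_right _ _))
  choose NJ HNJ using fun jk => HJ jk r hr (hrJ' jk)
  obtain ⟨NE, HNE⟩ := HE r hr hrE'
  -- ### the particle-number threshold
  refine ⟨max (Finset.univ.sup' Finset.univ_nonempty NJ) (max NE N₀E), fun N hN => ?_⟩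
  have hNJ : ∀ jk, NJ jk ≤ N := fun jk =>
    le_trans ((Finset.le_sup' NJ (Finset.mem_univ jk)).trans (le_max_left _ _)) hN
  have hNE : NE ≤ N := le_trans ((le_max_left _ _).trans (le_max_right _ _)) hN
  have hN₀E : N₀E ≤ N := le_trans ((le_max_right _ _).trans (le_max_right _ _)) hN
  set P := localGibbsLaw σ a₀ u₀ θ₀ N (Φ N) with hP
  haveI : IsProbabilityMeasure P := isProbabilityMeasure_localGibbsLaw ha hθc hu ha0 hθ0 hσ2 N (Φ N)
  -- ### the bad events
  set f : Phase N → ℝ := fun w => ((N : ℝ) + 1)⁻¹ * ∑ i, cubeTail M (w i).2 with hf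
  have hf0 : ∀ w, 0 ≤ f w := fun w => mul_nonneg (by positivity) (Finset.sum_nonneg fun i _ => cubeTail_nonneg M _)
  have hStail : P {z | κ < ∫ s in (0 : ℝ)..t, f ((Φ N).flow s z)} ≤ ENNReal.ofReal (δ / 12) := by
    have h1 := ChaosClosesEulerReadout.measure_lt_intervalIntegral_flow_le (Φ N) (μ := P)
      (localGibbsLaw_compl_good_eq_zero (Φ N)) (f := f) (measurable_mean_cubeTail M) hf0
      (fun z hz a b hab => intervalIntegrable_mean_cubeTail (Φ N) M hz hab) ht hεE.le
      (fun s hs => by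
        have h2 := hECT' N hN₀E s ⟨hs.1.le, hs.2⟩
        refine le_trans (lintegral_mono fun z => ENNReal.ofReal_le_ofReal ?_) h2
        refine mul_le_mul_of_nonneg_left (Finset.sum_le_sum fun i _ => ?_) (by positivity)
        exact cubeTail_antitone hM₀ _) hκ0
    refine h1.trans (ENNReal.ofReal_le_ofReal ?_)
    have h3 : (t - 0) * (δ / 12 * κ / (t + 1)) / κ = t * (δ / 12 / (t + 1)) := by
      rw [sub_zero, mul_div_assoc]
      congr 1
      field_simp
    rw [h3]
    exact mul_div_add_one_le ht hδ'.le
  have hSen : P {z | K < ((N : ℝ) + 1)⁻¹ * configEnergy ((Φ N).flow 0 z)} ≤ ENNReal.ofReal (δ / 12) :=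
    hKev N (Φ N) 0
  have hSJ : ∀ jk : Fin 3 × Fin 3, P {z | η' < ∫ s in Set.Icc 0 t, ∫ x,
      |h (rhoC r ((Φ N).flow s z) x, uC r ((Φ N).flow s z) x, thetaC r ((Φ N).flow s z) x)| *
        |MpsiC r ((Φ N).flow s z) x (psiJK M jk.1 jk.2) - rhoC r ((Φ N).flow s z) x *
          ∫ v, psiJK M jk.1 jk.2 v *
            localMaxwellian 1 (thetaC r ((Φ N).flow s z) x) (uC r ((Φ N).flow s z) x) v|} ≤
      ENNReal.ofReal (δ / 12) := fun jk => HNJ jk N (hNJ jk)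
  have hSE : P {z | η' < ∫ s in Set.Icc 0 t, ∫ x,
      |h (rhoC r ((Φ N).flow s z) x, uC r ((Φ N).flow s z) x, thetaC r ((Φ N).flow s z) x)| *
        |MpsiC r ((Φ N).flow s z) x (psiE M) - rhoC r ((Φ N).flow s z) x *
          ∫ v, psiE M v * localMaxwellian 1 (thetaC r ((Φ N).flow s z) x) (uC r ((Φ N).flow s z) x) v|} ≤
      ENNReal.ofReal (δ / 12) := HNE N hNE
  -- ### off the bad events: the pathwise estimate and the budget
  have hcov := measure_le_of_cover P (D := {z | η < |∫ s in Set.Icc 0 t, ∫ x,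
      g (σ ^ 3 * rhoC r ((Φ N).flow s z) x) * ∑ j, ∑ k, a j k (s, x) *
        (MpsiC r ((Φ N).flow s z) x (fun v => v j * v k) -
          momC r ((Φ N).flow s z) x j * momC r ((Φ N).flow s z) x k / rhoC r ((Φ N).flow s z) x)|})
    (localGibbsLaw_compl_good_eq_zero (Φ N)) hSen hStail hSE hSJ (fun z hz h1 h2 h3 h4 => by
      have hzg : z ∈ (Φ N).good := Set.notMem_compl_iff.1 hz
      simp only [Set.mem_setOf_eq, not_lt] at h1 h2 h3 ⊢
      have hKz : ke z ≤ K := by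
        rw [ke_eq_configEnergy, Nat.cast_succ, ← (Φ N).configEnergy_flow hzg 0]; exact h1
      have hκz : ∫ s in Set.Icc 0 t, f ((Φ N).flow s z) ≤ κ := by
        rwa [intervalIntegral.integral_of_le ht, ← integral_Icc_eq_integral_Ioc] at h2
      have hJz : ∀ j k : Fin 3, ∫ s in Set.Icc 0 t, ∫ x,
          |h (rhoC r ((Φ N).flow s z) x, uC r ((Φ N).flow s z) x, thetaC r ((Φ N).flow s z) x)| *
            |MpsiC r ((Φ N).flow s z) x (psiJK M j k) - rhoC r ((Φ N).flow s z) x *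
              ∫ v, psiJK M j k v * localMaxwellian 1 (thetaC r ((Φ N).flow s z) x) (uC r ((Φ N).flow s z) x) v| ≤
          η' := fun j k => by
        have h5 := h4 (j, k)
        simp only [Set.mem_setOf_eq, not_lt] at h5
        exact h5
      have hpw := pathwise_bound hMM hσ.le (Φ N) hzg hr hr2 ht a htr hA0 hA g hgc hGb0 hGb hρ₁0 hθ₁0 hΘ0 hU0
        hM h hh hKz hκz hJz h3
      exact hpw.trans (stub_stressIsotropyBudget hη ht hGb0 hA0 hK0 hθ₁ hΘ hU hρ₁ hκ hη'))
  have hcard : (3 + (Fintype.card (Fin 3 × Fin 3) : ℝ)) * (δ / 12) = δ := by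
    rw [Fintype.card_prod, Fintype.card_fin]; push_cast; ring
  rw [hcard] at hcov
  exact hcov

end Summit.AtomisticToContinuum.HydrodynamicLimit.Theorems.ChaosClosesEulerStressIsotropy

end
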